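import Summits.Ventures.PercRepro.S2LPCellP13D11
import Summits.Ventures.PercRepro.S2LPCellP12D11
import Summits.Ventures.PercRepro.S2LPCellP11D11
import Summits.Ventures.PercRepro.S2LPCellP10D11
import Summits.Ventures.PercRepro.S2LPPhi
import Summits.Ventures.PercRepro.S1RowNineAll
import Summits.Ventures.PercRepro.S1RowSevenAll
import Summits.Ventures.PercRepro.RankLevelSetPlaneTenPrime

/-!
# PercRepro — THE LEVEL-5 CELL `(13, 11)` OF THE `e`-FREE CORE, COLOOPS ALLOWED (p2, gen 30; generated by tools/gen_wrap5.py)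

`c025_core_five_thirteen_eleven`: every finite matroid of rank `13` on `24` points that is `e`-free satisfies
`ThmN.RLS M 13 5` — the statement of SUBCLAIM-S2's cell `(13, 11)`. With `c` coloops the core `M ＼ M.coloops` is
the coloop-free cell `(13 − c, 11)` at the constant `(Φ(13,5) − 2(2^c − 1))/2^c`, below the natural constant of that row
(the cells `s2lp_*` of the rows `10 … 13`); `c ≥ 4` coloops retire the cell by the lossy ladder alone.
Nothing else is claimed.

* **`c025_core_five_thirteen_eleven`**.
Axioms: standard.
-/

open scoped Matroid

namespace PercRepro

namespace S2LP

open Set Finset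

variable {α : Type}

/-- **THE LEVEL-5 CELL `(13, 11)` OF THE `e`-FREE CORE** (SUBCLAIM-S2's form). -/
theorem c025_core_five_thirteen_eleven (M : Matroid α) [M.Finite] (hR : M.eRank = ((13 : ℕ) : ℕ∞))
    (hn : M.E.ncard = 13 + 11)
    (hfree : ∀ e ∈ M.E, ∃ A ⊆ M.E \ {e}, e ∉ M.closure A ∧ e ∉ M.closure ((M.E \ {e}) \ A)) :
    ThmN.RLS M 13 5 := by
  have hpairs := S1.pairs_of_free M hfree
  have hlines := S1.lines_of_free M hfree
  have hplanes := S1.planes_of_free M hfree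
  have htens := S1.tens_of_free M hfree
  have hnineteen : ∀ X ⊆ M.E, M.eRk X ≤ 5 → X.ncard ≤ 19 :=
    fun X hX h => ThmN.ncard_le_nineteen_of_eRk_le_five_of_free M hfree hX h
  have hn' : M.E.ncard = 24 := by rw [hn]
  have hKfin : M.coloops.Finite := M.ground_finite.subset M.coloops_subset_ground
  have hcases : M.coloops.ncard = 0 ∨ M.coloops.ncard = 1 ∨ M.coloops.ncard = 2 ∨ M.coloops.ncard = 3 ∨ 4 ≤ M.coloops.ncard := by omega
  rcases hcases with hc0 | hc1 | hc2 | hc3 | hbig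
  · have hcol : M.coloops = ∅ := (ncard_eq_zero hKfin).1 hc0
    rw [ThmN.RLS_iff, phiK_thirteen_five]
    exact s2lp_13_24 M hR hn' hcol hpairs hlines hplanes htens hnineteen
  · -- `1` coloop: the core is the cell `(12, 11)`
    have hR' : M.eRank = ((12 + 1 : ℕ) : ℕ∞) := by rw [hR]
    obtain ⟨hNR, hNn, hNcol, -, -⟩ := ladder_delete_coloops 1 M 12 5 hR' (by norm_num) (by norm_num) hc1
    rw [ThmN.RLS_iff, phiK_thirteen_five]
    refine phi_mul_topCount_le_of_delete_coloops M hR' (by norm_num) (by norm_num) hc1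
      (κ := 127 / 7) (by norm_num) ?_
    exact s2lp_12_23 (M ＼ M.coloops) hNR (by omega) hNcol (pairs_delete M _ hpairs) (lines_delete M _ hlines)
      (fun X hX h => S1.size_delete hplanes _ X hX h) (fun X hX h => S1.size_delete htens _ X hX h)
      (fun X hX h => S1.size_delete hnineteen _ X hX h)
  · -- `2` coloops: the core is the cell `(11, 11)`
    have hR' : M.eRank = ((11 + 2 : ℕ) : ℕ∞) := by rw [hR]
    obtain ⟨hNR, hNn, hNcol, -, -⟩ := ladder_delete_coloops 2 M 11 5 hR' (by norm_num) (by norm_num) hc2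
    rw [ThmN.RLS_iff, phiK_thirteen_five]
    refine phi_mul_topCount_le_of_delete_coloops M hR' (by norm_num) (by norm_num) hc2
      (κ := 1991 / 168) (by norm_num) ?_
    exact s2lp_11_22 (M ＼ M.coloops) hNR (by omega) hNcol (pairs_delete M _ hpairs) (lines_delete M _ hlines)
      (fun X hX h => S1.size_delete hplanes _ X hX h) (fun X hX h => S1.size_delete htens _ X hX h)
      (fun X hX h => S1.size_delete hnineteen _ X hX h)
  · -- `3` coloops: the core is the cell `(10, 11)`
    have hR' : M.eRank = ((10 + 3 : ℕ) : ℕ∞) := by rw [hR]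
    obtain ⟨hNR, hNn, hNcol, -, -⟩ := ladder_delete_coloops 3 M 10 5 hR' (by norm_num) (by norm_num) hc3
    rw [ThmN.RLS_iff, phiK_thirteen_five]
    refine phi_mul_topCount_le_of_delete_coloops M hR' (by norm_num) (by norm_num) hc3
      (κ := 160 / 21) (by norm_num) ?_
    exact s2lp_10_21 (M ＼ M.coloops) hNR (by omega) hNcol (pairs_delete M _ hpairs) (lines_delete M _ hlines)
      (fun X hX h => S1.size_delete hplanes _ X hX h) (fun X hX h => S1.size_delete htens _ X hX h)
      (fun X hX h => S1.size_delete hnineteen _ X hX h)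
  · -- `≥ 4` coloops: the lossy ladder alone
    have hΦ : phiK (9 + 4) 5 ≤ 2 * ((2 : ℚ) ^ 4 - 1) := by
      rw [show (9 + 4 : ℕ) = 13 from rfl, phiK_thirteen_five]; norm_num
    have h := S1.rls_of_coloops_lossy_q M (p := 9) (q := 5) (c := 4) hR (by norm_num) (by norm_num) hbig hΦ
    exact h

end S2LP

end PercRepro
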